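import Literature.Algebra.Polynomial.CasasAlvero.Char113Digits
import Literature.Algebra.Polynomial.CasasAlvero.Degree6CandidatesPrime
import Literature.Algebra.Polynomial.CasasAlvero.Degree5
import Literature.Algebra.Polynomial.CasasAlvero.Degree6
import Literature.Algebra.Polynomial.CasasAlvero.DigitReduction
import HarnessLib

/-!
# Casas-Alvero degrees in characteristic 113: the complete classification

Over EVERY field `K` of characteristic `113`: `CA_d(K) ⟺ d = 0 ∨ d = a·113^k` with `1 ≤ a ≤ 6`.
Ingredients: the digit reduction `CA_d ⇒ d = a·p^k ∧ CA_a` (`DigitReduction.lean`, any field); the positive digits `1, 2, 3, 4`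
([GrafVonBothmerEtAl2007, Props. 2, 6]), `5` (`Degree5.lean`) and `6` (`113` is not among the `54` candidate bad primes of degree `6` of `Degree6CandidatesPrime.lean`, so `CA_6` holds in characteristic `113` —
a GOOD prime for degree `6` [CastryckLaterveerOunaies2012, Thm. 4] — and `CA_{6·p^k}` descends from the algebraic closure); and a refutation of every digit `7 ≤ a ≤ 112` over every field of characteristic `113`:
`7` by the sparse `𝔽_113`-septic of `Char113Digits.lean` (the degree-7 table of `BadDegrees.lean` stops at `61`); `12, 20, 26, 28, 31, 38, 39, 49, 52, 58, 60, 64, 67, 71, 74, 76, 80, 84, 87, 89, 90, 93, 94, 95, 96, 98, 101, 102, 106, 109, 110, 112` by the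
binomial criterion (`m = 5, 6, 3, 9, 14, 16, 19, 4, 13, 6, 6, 32, 4, 23, 9, 37, 32, 9, 3, 41, 16, 20, 47, 11, 22, 6, 17, 10, 14, 25, 41, 2`); and the 73 remaining digits by the sparse `𝔽_113`-examples of `Char113Digits.lean`.
-/

noncomputable section

open Polynomial

namespace Literature.Algebra.Polynomial.CasasAlvero

variable (K : Type*) [Field K] [CharP K 113]


/-- `CA_{6·113^k}` over every field of characteristic `113` (`CA_6` itself — the case `k = 0` — holds because `113` is not among the
`54` candidate bad primes of degree `6` of `Degree6CandidatesPrime.lean`, `holdsInDegree_six_of_not_mem`, i.e. `113` is a GOOD prime for degree `6`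
[cite: CastryckLaterveerOunaies2012, Thm. 4]). [cite: GrafVonBothmerEtAl2007, Prop. 6] -/
theorem holdsInDegree_six_mul_pow_of_char_113' (k : ℕ) : HoldsInDegree K (6 * 113 ^ k) := by
  haveI : Fact (Nat.Prime 113) := ⟨by norm_num⟩
  exact holdsInDegree_mul_prime_pow_field K 113 (holdsInDegree_six_of_not_mem (K := AlgebraicClosure K) 113 (by decide)) k

/-- every digit `7 ≤ a < 113` fails: `¬ CA_a` over every field of characteristic `113` — the bad-prime computations of
[cite: CastryckLaterveerOunaies2012, Thm. 4] (degrees `≤ 7`) extended to every digit below `113` by explicit `𝔽_113`-rational examples and the binomial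
criterion. [cite: GrafVonBothmerEtAl2007, Prop. 6] -/
theorem not_holdsInDegree_digit_of_char_oneHundredThirteen {a : ℕ} (h7 : 7 ≤ a) (hap : a < 113) : ¬ HoldsInDegree K a := by
  haveI : Fact (Nat.Prime 113) := ⟨by norm_num⟩
  interval_cases a
  · exact not_holdsInDegree_seven_of_char_113 K
  · exact not_holdsInDegree_eight_of_char_113 K
  · exact not_holdsInDegree_nine_of_char_113 K
  · exact not_holdsInDegree_ten_of_char_113 K
  · exact not_holdsInDegree_eleven_of_char_113 K
  · exact not_holdsInDegree_of_choose_modEq_one K 113 (d := 12) (m := 5) (by norm_num) (by norm_num) (by decide)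
  · exact not_holdsInDegree_thirteen_of_char_113 K
  · exact not_holdsInDegree_fourteen_of_char_113 K
  · exact not_holdsInDegree_fifteen_of_char_113 K
  · exact not_holdsInDegree_sixteen_of_char_113 K
  · exact not_holdsInDegree_seventeen_of_char_113 K
  · exact not_holdsInDegree_eighteen_of_char_113 K
  · exact not_holdsInDegree_nineteen_of_char_113 K
  · exact not_holdsInDegree_of_choose_modEq_one K 113 (d := 20) (m := 6) (by norm_num) (by norm_num) (by decide)
  · exact not_holdsInDegree_twentyOne_of_char_113 K
  · exact not_holdsInDegree_twentyTwo_of_char_113 K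
  · exact not_holdsInDegree_twentyThree_of_char_113 K
  · exact not_holdsInDegree_twentyFour_of_char_113 K
  · exact not_holdsInDegree_twentyFive_of_char_113 K
  · exact not_holdsInDegree_of_choose_modEq_one K 113 (d := 26) (m := 3) (by norm_num) (by norm_num) (by decide)
  · exact not_holdsInDegree_twentySeven_of_char_113 K
  · exact not_holdsInDegree_of_choose_modEq_one K 113 (d := 28) (m := 9) (by norm_num) (by norm_num) (by decide)
  · exact not_holdsInDegree_twentyNine_of_char_113 K
  · exact not_holdsInDegree_thirty_of_char_113 K
  · exact not_holdsInDegree_of_choose_modEq_one K 113 (d := 31) (m := 14) (by norm_num) (by norm_num) (by decide)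
  · exact not_holdsInDegree_thirtyTwo_of_char_113 K
  · exact not_holdsInDegree_thirtyThree_of_char_113 K
  · exact not_holdsInDegree_thirtyFour_of_char_113 K
  · exact not_holdsInDegree_thirtyFive_of_char_113 K
  · exact not_holdsInDegree_thirtySix_of_char_113 K
  · exact not_holdsInDegree_thirtySeven_of_char_113 K
  · exact not_holdsInDegree_of_choose_modEq_one K 113 (d := 38) (m := 16) (by norm_num) (by norm_num) (by decide)
  · exact not_holdsInDegree_of_choose_modEq_one K 113 (d := 39) (m := 19) (by norm_num) (by norm_num) (by decide)
  · exact not_holdsInDegree_forty_of_char_113 K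
  · exact not_holdsInDegree_fortyOne_of_char_113 K
  · exact not_holdsInDegree_fortyTwo_of_char_113 K
  · exact not_holdsInDegree_fortyThree_of_char_113 K
  · exact not_holdsInDegree_fortyFour_of_char_113 K
  · exact not_holdsInDegree_fortyFive_of_char_113 K
  · exact not_holdsInDegree_fortySix_of_char_113 K
  · exact not_holdsInDegree_fortySeven_of_char_113 K
  · exact not_holdsInDegree_fortyEight_of_char_113 K
  · exact not_holdsInDegree_of_choose_modEq_one K 113 (d := 49) (m := 4) (by norm_num) (by norm_num) (by decide)
  · exact not_holdsInDegree_fifty_of_char_113 K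
  · exact not_holdsInDegree_fiftyOne_of_char_113 K
  · exact not_holdsInDegree_of_choose_modEq_one K 113 (d := 52) (m := 13) (by norm_num) (by norm_num) (by decide)
  · exact not_holdsInDegree_fiftyThree_of_char_113 K
  · exact not_holdsInDegree_fiftyFour_of_char_113 K
  · exact not_holdsInDegree_fiftyFive_of_char_113 K
  · exact not_holdsInDegree_fiftySix_of_char_113 K
  · exact not_holdsInDegree_fiftySeven_of_char_113 K
  · exact not_holdsInDegree_of_choose_modEq_one K 113 (d := 58) (m := 6) (by norm_num) (by norm_num) (by decide)
  · exact not_holdsInDegree_fiftyNine_of_char_113 K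
  · exact not_holdsInDegree_of_choose_modEq_one K 113 (d := 60) (m := 6) (by norm_num) (by norm_num) (by decide)
  · exact not_holdsInDegree_sixtyOne_of_char_113 K
  · exact not_holdsInDegree_sixtyTwo_of_char_113 K
  · exact not_holdsInDegree_sixtyThree_of_char_113 K
  · exact not_holdsInDegree_of_choose_modEq_one K 113 (d := 64) (m := 32) (by norm_num) (by norm_num) (by decide)
  · exact not_holdsInDegree_sixtyFive_of_char_113 K
  · exact not_holdsInDegree_sixtySix_of_char_113 K
  · exact not_holdsInDegree_of_choose_modEq_one K 113 (d := 67) (m := 4) (by norm_num) (by norm_num) (by decide)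
  · exact not_holdsInDegree_sixtyEight_of_char_113 K
  · exact not_holdsInDegree_sixtyNine_of_char_113 K
  · exact not_holdsInDegree_seventy_of_char_113 K
  · exact not_holdsInDegree_of_choose_modEq_one K 113 (d := 71) (m := 23) (by norm_num) (by norm_num) (by decide)
  · exact not_holdsInDegree_seventyTwo_of_char_113 K
  · exact not_holdsInDegree_seventyThree_of_char_113 K
  · exact not_holdsInDegree_of_choose_modEq_one K 113 (d := 74) (m := 9) (by norm_num) (by norm_num) (by decide)
  · exact not_holdsInDegree_seventyFive_of_char_113 K
  · exact not_holdsInDegree_of_choose_modEq_one K 113 (d := 76) (m := 37) (by norm_num) (by norm_num) (by decide)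
  · exact not_holdsInDegree_seventySeven_of_char_113 K
  · exact not_holdsInDegree_seventyEight_of_char_113 K
  · exact not_holdsInDegree_seventyNine_of_char_113 K
  · exact not_holdsInDegree_of_choose_modEq_one K 113 (d := 80) (m := 32) (by norm_num) (by norm_num) (by decide)
  · exact not_holdsInDegree_eightyOne_of_char_113 K
  · exact not_holdsInDegree_eightyTwo_of_char_113 K
  · exact not_holdsInDegree_eightyThree_of_char_113 K
  · exact not_holdsInDegree_of_choose_modEq_one K 113 (d := 84) (m := 9) (by norm_num) (by norm_num) (by decide)
  · exact not_holdsInDegree_eightyFive_of_char_113 K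
  · exact not_holdsInDegree_eightySix_of_char_113 K
  · exact not_holdsInDegree_of_choose_modEq_one K 113 (d := 87) (m := 3) (by norm_num) (by norm_num) (by decide)
  · exact not_holdsInDegree_eightyEight_of_char_113 K
  · exact not_holdsInDegree_of_choose_modEq_one K 113 (d := 89) (m := 41) (by norm_num) (by norm_num) (by decide)
  · exact not_holdsInDegree_of_choose_modEq_one K 113 (d := 90) (m := 16) (by norm_num) (by norm_num) (by decide)
  · exact not_holdsInDegree_ninetyOne_of_char_113 K
  · exact not_holdsInDegree_ninetyTwo_of_char_113 K
  · exact not_holdsInDegree_of_choose_modEq_one K 113 (d := 93) (m := 20) (by norm_num) (by norm_num) (by decide)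
  · exact not_holdsInDegree_of_choose_modEq_one K 113 (d := 94) (m := 47) (by norm_num) (by norm_num) (by decide)
  · exact not_holdsInDegree_of_choose_modEq_one K 113 (d := 95) (m := 11) (by norm_num) (by norm_num) (by decide)
  · exact not_holdsInDegree_of_choose_modEq_one K 113 (d := 96) (m := 22) (by norm_num) (by norm_num) (by decide)
  · exact not_holdsInDegree_ninetySeven_of_char_113 K
  · exact not_holdsInDegree_of_choose_modEq_one K 113 (d := 98) (m := 6) (by norm_num) (by norm_num) (by decide)
  · exact not_holdsInDegree_ninetyNine_of_char_113 K
  · exact not_holdsInDegree_oneHundred_of_char_113 K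
  · exact not_holdsInDegree_of_choose_modEq_one K 113 (d := 101) (m := 17) (by norm_num) (by norm_num) (by decide)
  · exact not_holdsInDegree_of_choose_modEq_one K 113 (d := 102) (m := 10) (by norm_num) (by norm_num) (by decide)
  · exact not_holdsInDegree_oneHundredThree_of_char_113 K
  · exact not_holdsInDegree_oneHundredFour_of_char_113 K
  · exact not_holdsInDegree_oneHundredFive_of_char_113 K
  · exact not_holdsInDegree_of_choose_modEq_one K 113 (d := 106) (m := 14) (by norm_num) (by norm_num) (by decide)
  · exact not_holdsInDegree_oneHundredSeven_of_char_113 K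
  · exact not_holdsInDegree_oneHundredEight_of_char_113 K
  · exact not_holdsInDegree_of_choose_modEq_one K 113 (d := 109) (m := 25) (by norm_num) (by norm_num) (by decide)
  · exact not_holdsInDegree_of_choose_modEq_one K 113 (d := 110) (m := 41) (by norm_num) (by norm_num) (by decide)
  · exact not_holdsInDegree_oneHundredEleven_of_char_113 K
  · exact not_holdsInDegree_of_choose_modEq_one K 113 (d := 112) (m := 2) (by norm_num) (by norm_num) (by decide)

/-- the positive digits `1 ≤ a ≤ 5`: `CA_{a·113^k}` over every field of characteristic `113`. [cite: GrafVonBothmerEtAl2007, Props. 2, 6]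
[cite: CastryckLaterveerOunaies2012, Thm. 4] -/
theorem holdsInDegree_mul_oneHundredThirteen_pow_of_le_five {a : ℕ} (ha0 : 0 < a) (ha5 : a ≤ 5) (k : ℕ) :
    HoldsInDegree K (a * 113 ^ k) := by
  haveI : Fact (Nat.Prime 113) := ⟨by norm_num⟩
  interval_cases a
  · simpa using holdsInDegree_prime_pow_field K 113 k
  · exact holdsInDegree_two_mul_prime_pow_field K 113 k
  · exact holdsInDegree_three_mul_prime_pow_field K 113 (by norm_num) k
  · exact holdsInDegree_mul_prime_pow_field K 113
      (holdsInDegree_of_le_four_of_charP (AlgebraicClosure K) 113 (by norm_num) le_rfl) k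
  · exact holdsInDegree_five_mul_prime_pow_field K 113 (by norm_num) (by norm_num) (by norm_num) (by norm_num)
      (by norm_num) (by norm_num) (by norm_num) (by norm_num) (by norm_num) k

/-- **characteristic 113, complete**: over every field of characteristic `113`,
`CA_d ⟺ d = 0 ∨ d = a·113^k` with `1 ≤ a ≤ 6`. [cite: GrafVonBothmerEtAl2007, Props. 2, 6, 7]
[cite: CastryckLaterveerOunaies2012, Thm. 4] -/
theorem classification_char_oneHundredThirteen_complete (d : ℕ) :
    HoldsInDegree K d ↔ d = 0 ∨ ∃ k a : ℕ, 0 < a ∧ a ≤ 6 ∧ d = a * 113 ^ k := by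
  haveI : Fact (Nat.Prime 113) := ⟨by norm_num⟩
  constructor
  · intro h
    rcases Nat.eq_zero_or_pos d with rfl | hd
    · exact Or.inl rfl
    obtain ⟨k, a, ha0, hap, rfl, ha⟩ := digit_of_holdsInDegree K 113 hd.ne' h
    refine Or.inr ⟨k, a, ha0, ?_, rfl⟩
    by_contra h6
    exact not_holdsInDegree_digit_of_char_oneHundredThirteen K (by omega) hap ha
  · rintro (rfl | ⟨k, a, ha0, ha6, rfl⟩)
    · exact holdsInDegree_zero K
    · rcases Nat.lt_or_ge a 6 with ha | ha
      · exact holdsInDegree_mul_oneHundredThirteen_pow_of_le_five K ha0 (by omega) k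
      · obtain rfl : a = 6 := le_antisymm ha6 ha
        exact holdsInDegree_six_mul_pow_of_char_113' K k

/-- the set of Casas-Alvero degrees `≤ 12769` in characteristic `113`, explicitly (corollary of the classification:
[cite: GrafVonBothmerEtAl2007, Prop. 6] with [cite: CastryckLaterveerOunaies2012, Thm. 4] and the digit refutations above). -/
theorem holdsInDegree_iff_mem_of_le_char_oneHundredThirteen_sq {d : ℕ} (hd : d ≤ 12769) :
    HoldsInDegree K d ↔ d ∈ ({0, 1, 2, 3, 4, 5, 6, 113, 226, 339, 452, 565, 678, 12769} : Finset ℕ) := by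
  rw [classification_char_oneHundredThirteen_complete]
  constructor
  · rintro (rfl | ⟨k, a, ha0, ha6, rfl⟩)
    · decide
    · rcases k with _ | _ | _ | k
      · interval_cases a <;> decide
      · interval_cases a <;> decide
      · interval_cases a <;> simp_all
      · exfalso
        have : 113 ^ 3 ≤ a * 113 ^ (k + 1 + 1 + 1) :=
          le_trans (Nat.pow_le_pow_right (by norm_num) (by omega)) (Nat.le_mul_of_pos_left _ ha0)
        omega
  · intro h
    simp only [Finset.mem_insert, Finset.mem_singleton] at h
    rcases h with rfl | rfl | rfl | rfl | rfl | rfl | rfl | rfl | rfl | rfl | rfl | rfl | rfl | rfl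
    · exact Or.inl rfl
    · exact Or.inr ⟨0, 1, by norm_num, by norm_num, by norm_num⟩
    · exact Or.inr ⟨0, 2, by norm_num, by norm_num, by norm_num⟩
    · exact Or.inr ⟨0, 3, by norm_num, by norm_num, by norm_num⟩
    · exact Or.inr ⟨0, 4, by norm_num, by norm_num, by norm_num⟩
    · exact Or.inr ⟨0, 5, by norm_num, by norm_num, by norm_num⟩
    · exact Or.inr ⟨0, 6, by norm_num, by norm_num, by norm_num⟩
    · exact Or.inr ⟨1, 1, by norm_num, by norm_num, by norm_num⟩
    · exact Or.inr ⟨1, 2, by norm_num, by norm_num, by norm_num⟩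
    · exact Or.inr ⟨1, 3, by norm_num, by norm_num, by norm_num⟩
    · exact Or.inr ⟨1, 4, by norm_num, by norm_num, by norm_num⟩
    · exact Or.inr ⟨1, 5, by norm_num, by norm_num, by norm_num⟩
    · exact Or.inr ⟨1, 6, by norm_num, by norm_num, by norm_num⟩
    · exact Or.inr ⟨2, 1, by norm_num, by norm_num, by norm_num⟩

end Literature.Algebra.Polynomial.CasasAlvero
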